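import Literature.NumberTheory.Automorphic.ParabolicInductionRefinementProofs
import Literature.NumberTheory.Automorphic.ParabolicInductionLeviCartanProofs
import HarnessLib

/-!
# The unipotent group of a cut: parametrisation, filtration by levels, contraction
(sibling proof file towards `Literature.NumberTheory.Automorphic.bernsteinZelevinsky_support`)

Let `c : Fin n → Fin r` be a block labelling, `p : Fin n`, and `U = cutUnipotent F c p` the
unipotent radical of the cut after `p` inside the Levi `M = Π_a GL(B_a, F)`
(`ParabolicInductionRefinementProofs`). This file supplies the concrete analysis of `U` used in
Harish-Chandra's argument "quasi-cuspidal ⟹ compactly supported coefficients"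
(Bernstein–Zelevinsky 1976, §3; Casselman 1995, §5–6; for the support theorem of
Bernstein–Zelevinsky 1977, Thm. 2.5):

* `cutElem c p X ∈ M` (`X` a matrix on the block of `p`): the element which is `1 + T X` in the
  block of `p` (`T` = truncation to the rows `≤ p`, columns `> p`, `cutTrunc`) and `1` elsewhere;
  `X ↦ cutElem c p X` is an additive-to-multiplicative homomorphism (`cutElem_add`), continuous
  (`continuous_cutElem`), with image exactly `U` (`cutElem_mem_cutUnipotent`,
  `exists_eq_cutElem_of_mem_cutUnipotent`);
* the **levels** `cutLevel p ϖ t = {X | |X i j| ≤ |ϖ|^t}` (`t ∈ ℤ`): decreasing in `t`, exhausting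
  (`exists_mem_cutLevel`: "`U` is the union of its compact open subgroups `U_t`"), and eventually
  inside every neighbourhood of `0` (`exists_cutLevel_subset_of_mem_nhds`);
* consequences for a smooth representation `τ` of `M`: a smooth linear form is invariant under
  `cutElem` of a deep enough level (`exists_forall_apply_cutElem_eq`), and an element of the span
  `W(U)` of the `τ(u) y - y` already lies in `W(U_t)` for some level `t`
  (`exists_mem_span_cutLevel_of_mem_coinvariantsKer`) — Jacquet's observation that `V(U)` is the
  union of the `V(U_t)`;
* **contraction by the torus** (`leviZpowDiag_mul_cutElem_mul_inv`,
  `conj_mem_cutLevel_of_gap`): `diag(ϖ^e) (1 + T X) diag(ϖ^e)⁻¹ = 1 + T (ϖ^{e i - e j} X i j)`, and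
  if `e` is antitone on the block of `p` with gap `e p - e (p+1) ≥ G` at the cut then the level
  rises by `G`.

Definitions (`cutTrunc`, `cutGL`, `cutElem`, `cutLevel`, `cutScale`) are real; everything is
proved; no named facts.

## References

* I. N. Bernstein, A. V. Zelevinsky, *Representations of the group `GL(n, F)` where `F` is a
  non-archimedean local field*, Russian Math. Surveys 31:3 (1976), §3 (3.13–3.18).
* W. Casselman, *Introduction to the theory of admissible representations of `p`-adic reductive
  groups* (1995 notes), Prop. 1.4.3, §5.
* I. N. Bernstein, A. V. Zelevinsky, *Induced representations of reductive `p`-adic groups I*,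
  Ann. Sci. ÉNS 10 (1977), §2.3–2.5.
-/

noncomputable section

open scoped MatrixGroups Topology
open ValuativeRel Filter

namespace Literature.NumberTheory.Automorphic

/-! ### The matrices of the cut and the elements `cutElem` -/

section CutElem

variable {F : Type*} [Field F] {n r : ℕ} (c : Fin n → Fin r) (p : Fin n)

/-- Truncation of a matrix on the block of `p` to the positions of the cut: rows `≤ p`, columns
`> p`. [folklore] -/
def cutTrunc (X : Matrix {i // c i = c p} {i // c i = c p} F) :
    Matrix {i // c i = c p} {i // c i = c p} F :=
  Matrix.of fun i j => if i.1 ≤ p ∧ p < j.1 then X i j else 0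

/-- Entries of the truncation. [folklore] -/
lemma cutTrunc_apply (X : Matrix {i // c i = c p} {i // c i = c p} F) (i j : {i // c i = c p}) :
    cutTrunc c p X i j = if i.1 ≤ p ∧ p < j.1 then X i j else 0 :=
  rfl

/-- Two truncated matrices multiply to zero (a column index `> p` is never a row index `≤ p`).
[folklore] -/
lemma cutTrunc_mul_cutTrunc (X Y : Matrix {i // c i = c p} {i // c i = c p} F) :
    cutTrunc c p X * cutTrunc c p Y = 0 := by
  ext i j
  rw [Matrix.mul_apply, Matrix.zero_apply]
  refine Finset.sum_eq_zero fun k _ => ?_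
  rw [cutTrunc_apply, cutTrunc_apply]
  by_cases h1 : i.1 ≤ p ∧ p < k.1
  · rw [if_neg (show ¬ (k.1 ≤ p ∧ p < j.1) from fun h2 => absurd (h1.2.trans_le h2.1) (lt_irrefl p)),
      mul_zero]
  · rw [if_neg h1, zero_mul]

/-- Truncation is additive. [folklore] -/
lemma cutTrunc_add (X Y : Matrix {i // c i = c p} {i // c i = c p} F) :
    cutTrunc c p (X + Y) = cutTrunc c p X + cutTrunc c p Y := by
  ext i j
  simp only [cutTrunc_apply, Matrix.add_apply]
  split_ifs <;> simp

/-- Truncation commutes with negation. [folklore] -/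
lemma cutTrunc_neg (X : Matrix {i // c i = c p} {i // c i = c p} F) :
    cutTrunc c p (-X) = -cutTrunc c p X := by
  ext i j
  simp only [cutTrunc_apply, Matrix.neg_apply]
  split_ifs <;> simp

/-- Truncation of `0` is `0`. [folklore] -/
lemma cutTrunc_zero : cutTrunc c p (0 : Matrix {i // c i = c p} {i // c i = c p} F) = 0 := by
  ext i j
  simp only [cutTrunc_apply, Matrix.zero_apply]
  split_ifs <;> simp

/-- The invertible matrix `1 + T X` on the block of `p` (inverse `1 - T X`, as `(T X)² = 0`).
[folklore] -/
def cutGL (X : Matrix {i // c i = c p} {i // c i = c p} F) : GL {i // c i = c p} F where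
  val := 1 + cutTrunc c p X
  inv := 1 - cutTrunc c p X
  val_inv := by
    rw [add_mul, mul_sub, mul_sub, one_mul, one_mul, mul_one, cutTrunc_mul_cutTrunc, sub_zero,
      sub_add_cancel]
  inv_val := by
    rw [sub_mul, mul_add, mul_add, one_mul, one_mul, mul_one, cutTrunc_mul_cutTrunc, add_zero,
      add_sub_cancel_right]

/-- The matrix of `cutGL c p X` is `1 + T X`. [folklore] -/
@[simp] lemma coe_cutGL (X : Matrix {i // c i = c p} {i // c i = c p} F) :
    ((cutGL c p X : GL {i // c i = c p} F) : Matrix _ _ F) = 1 + cutTrunc c p X :=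
  rfl

/-- `X ↦ 1 + T X` is additive-to-multiplicative. [folklore] -/
lemma cutGL_add (X Y : Matrix {i // c i = c p} {i // c i = c p} F) :
    cutGL c p (X + Y) = cutGL c p X * cutGL c p Y := by
  refine Units.ext ?_
  rw [Units.val_mul, coe_cutGL, coe_cutGL, coe_cutGL, cutTrunc_add, add_mul, mul_add, mul_add,
    one_mul, one_mul, mul_one, cutTrunc_mul_cutTrunc, add_zero]
  abel

/-- `cutGL c p 0 = 1`. [folklore] -/
lemma cutGL_zero : cutGL c p (0 : Matrix {i // c i = c p} {i // c i = c p} F) = 1 := by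
  refine Units.ext ?_
  rw [coe_cutGL, cutTrunc_zero, add_zero, Units.val_one]

/-- `cutGL c p (-X) = (cutGL c p X)⁻¹`. [folklore] -/
lemma cutGL_neg (X : Matrix {i // c i = c p} {i // c i = c p} F) :
    cutGL c p (-X) = (cutGL c p X)⁻¹ := by
  rw [eq_inv_iff_mul_eq_one, ← cutGL_add, neg_add_cancel, cutGL_zero]

/-- **The element of the cut unipotent group attached to a matrix `X`**: `1 + T X` in the block
of `p`, the identity in the other blocks (Mathlib `Pi.mulSingle`). (The one-parameter
description of the unipotent radical of a maximal parabolic of a block; Bernstein–Zelevinsky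
1977, §2.1.) [folklore] -/
def cutElem (X : Matrix {i // c i = c p} {i // c i = c p} F) : Π a, GL {i // c i = a} F :=
  Pi.mulSingle (c p) (cutGL c p X)

/-- The block of `p` of `cutElem c p X` is `1 + T X`. [folklore] -/
@[simp] lemma cutElem_apply_self (X : Matrix {i // c i = c p} {i // c i = c p} F) :
    cutElem c p X (c p) = cutGL c p X :=
  Pi.mulSingle_eq_same _ _

/-- The other blocks of `cutElem c p X` are `1`. [folklore] -/
lemma cutElem_apply_of_ne (X : Matrix {i // c i = c p} {i // c i = c p} F) {a : Fin r}
    (ha : a ≠ c p) : cutElem c p X a = 1 :=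
  Pi.mulSingle_eq_of_ne ha _

/-- `cutElem` is additive-to-multiplicative. [folklore] -/
lemma cutElem_add (X Y : Matrix {i // c i = c p} {i // c i = c p} F) :
    cutElem c p (X + Y) = cutElem c p X * cutElem c p Y := by
  rw [cutElem, cutElem, cutElem, cutGL_add, Pi.mulSingle_mul]

/-- `cutElem c p 0 = 1`. [folklore] -/
lemma cutElem_zero : cutElem c p (0 : Matrix {i // c i = c p} {i // c i = c p} F) = 1 := by
  rw [cutElem, cutGL_zero, Pi.mulSingle_one]

/-- `cutElem c p (-X) = (cutElem c p X)⁻¹`. [folklore] -/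
lemma cutElem_neg (X : Matrix {i // c i = c p} {i // c i = c p} F) :
    cutElem c p (-X) = (cutElem c p X)⁻¹ := by
  rw [cutElem, cutElem, cutGL_neg, Pi.mulSingle_inv]

/-- `cutElem c p X` lies in the cut unipotent group `cutUnipotent F c p`. [folklore] -/
theorem cutElem_mem_cutUnipotent (X : Matrix {i // c i = c p} {i // c i = c p} F) :
    cutElem c p X ∈ cutUnipotent F c p := by
  refine ⟨fun a ha => cutElem_apply_of_ne c p X ha, ?_⟩
  rw [cutElem_apply_self, mem_unipotentRadicalGL_iff]
  refine ⟨fun i j hij => ?_, fun b => ?_⟩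
  · simp only [cutLabel, Bool.lt_iff, decide_eq_false_iff_not, not_lt, decide_eq_true_eq] at hij
    have hne : i ≠ j := fun h => by rw [h] at hij; exact absurd (hij.1.trans_lt hij.2) (lt_irrefl _)
    rw [coe_cutGL, Matrix.add_apply, Matrix.one_apply_ne hne, cutTrunc_apply, if_neg, add_zero]
    exact fun h => absurd (hij.2.trans_le h.1) (lt_irrefl p)
  · ext i j
    have hcut : ¬ ((i : {k // c k = c p}).1 ≤ p ∧ p < (j : {k // c k = c p}).1) := by
      rintro ⟨h1, h2⟩
      have hb : cutLabel c p i = cutLabel c p j := i.2.trans j.2.symm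
      simp only [cutLabel, decide_eq_decide] at hb
      exact absurd (hb.2 h2) (not_lt.2 h1)
    rw [Matrix.toSquareBlock_def, Matrix.of_apply, coe_cutGL, Matrix.add_apply, cutTrunc_apply,
      if_neg hcut, add_zero]
    by_cases h : i = j
    · subst h; simp
    · rw [Matrix.one_apply_ne h, Matrix.one_apply_ne (fun e => h (Subtype.ext e))]

/-- **Every element of the cut unipotent group is a `cutElem`** (take `X` = its block of `p`):
the image of `X ↦ cutElem c p X` is exactly `cutUnipotent F c p`. [folklore] -/
theorem exists_eq_cutElem_of_mem_cutUnipotent {m : Π a, GL {i // c i = a} F}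
    (hm : m ∈ cutUnipotent F c p) :
    ∃ X : Matrix {i // c i = c p} {i // c i = c p} F, m = cutElem c p X := by
  refine ⟨(m (c p) : Matrix _ _ F), ?_⟩
  have hBT : ((m (c p) : GL _ F) : Matrix _ _ F).BlockTriangular (cutLabel c p) :=
    ((mem_unipotentRadicalGL_iff _ _).1 hm.2).1
  have hent := apply_eq_of_mem_unipotentRadicalGL (cutLabel c p) hm.2
  funext a
  by_cases ha : a = c p
  · subst ha
    rw [cutElem_apply_self]
    refine Units.ext (Matrix.ext fun i j => ?_)
    rw [coe_cutGL, Matrix.add_apply, cutTrunc_apply]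
    by_cases hij : i = j
    · subst hij
      rw [hent i i rfl, if_pos rfl, Matrix.one_apply_eq, if_neg, add_zero]
      exact fun h => absurd (h.1.trans_lt h.2) (lt_irrefl _)
    · rw [Matrix.one_apply_ne hij, zero_add]
      by_cases hcut : i.1 ≤ p ∧ p < j.1
      · rw [if_pos hcut]
      · rw [if_neg hcut]
        by_cases hlab : cutLabel c p i = cutLabel c p j
        · rw [hent i j hlab, if_neg hij]
        · -- labels differ and not a cut position: then `label j < label i`
          refine hBT ?_
          simp only [cutLabel, Bool.lt_iff, decide_eq_false_iff_not, not_lt, decide_eq_true_eq]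
          simp only [cutLabel, decide_eq_decide, not_iff] at hlab
          by_cases hi : p < i.1
          · have hj : ¬ p < j.1 := fun hj => (hlab.2 hj) hi
            exact ⟨not_lt.1 hj, hi⟩
          · exact absurd ⟨not_lt.1 hi, hlab.1 hi⟩ hcut
  · rw [cutElem_apply_of_ne c p _ ha, hm.1 a ha]

end CutElem

/-! ### Continuity of `cutElem` -/

section Continuity

variable {F : Type*} [Field F] [TopologicalSpace F] [IsTopologicalRing F] {n r : ℕ}
  (c : Fin n → Fin r) (p : Fin n)

omit [IsTopologicalRing F] in
/-- Truncation is continuous. [folklore] -/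
lemma continuous_cutTrunc : Continuous (cutTrunc (F := F) c p) := by
  refine continuous_matrix fun i j => ?_
  by_cases h : i.1 ≤ p ∧ p < j.1
  · simp only [cutTrunc_apply, if_pos h]
    exact continuous_id.matrix_elem i j
  · simp only [cutTrunc_apply, if_neg h]
    exact continuous_const

/-- `X ↦ cutElem c p X` is continuous (into the product of the unit groups). [folklore] -/
theorem continuous_cutElem :
    Continuous (cutElem c p : Matrix {i // c i = c p} {i // c i = c p} F → Π a, GL {i // c i = a} F) := by
  have h : Continuous (cutGL c p : Matrix {i // c i = c p} {i // c i = c p} F → GL {i // c i = c p} F) := by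
    refine Units.continuous_iff.2 ⟨?_, ?_⟩
    · exact continuous_const.add (continuous_cutTrunc c p)
    · change Continuous fun X => (1 : Matrix _ _ F) - cutTrunc c p X
      exact continuous_const.sub (continuous_cutTrunc c p)
  exact (continuous_mulSingle (c p)).comp h

end Continuity

/-! ### Levels -/

section Level

variable {F : Type*} [Field F] [ValuativeRel F] {n r : ℕ} (c : Fin n → Fin r) (p : Fin n) (ϖ : F)

/-- The **level-`t` matrices** on the block of `p`: all entries of valuation `≤ |ϖ|^t` (`t ∈ ℤ`).
Their images `cutElem (cutLevel t)` are the compact open subgroups `U_t` filtering the cut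
unipotent group. [folklore] -/
def cutLevel (t : ℤ) : Set (Matrix {i // c i = c p} {i // c i = c p} F) :=
  {X | ∀ i j, valuation F (X i j) ≤ valuation F ϖ ^ t}

variable {c p ϖ}

/-- Membership in a level (definitional unfolding). [folklore] -/
lemma mem_cutLevel_iff {t : ℤ} {X : Matrix {i // c i = c p} {i // c i = c p} F} :
    X ∈ cutLevel c p ϖ t ↔ ∀ i j, valuation F (X i j) ≤ valuation F ϖ ^ t :=
  Iff.rfl

/-- Levels are symmetric under negation. [folklore] -/
lemma neg_mem_cutLevel {t : ℤ} {X : Matrix {i // c i = c p} {i // c i = c p} F}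
    (hX : X ∈ cutLevel c p ϖ t) : -X ∈ cutLevel c p ϖ t := fun i j => by
  rw [Matrix.neg_apply, Valuation.map_neg]
  exact hX i j

/-- Levels decrease as `t` increases (for `|ϖ| ≤ 1`, `ϖ ≠ 0`). [folklore] -/
lemma cutLevel_anti (hϖ0 : ϖ ≠ 0) (hϖ1 : valuation F ϖ ≤ 1) {t t' : ℤ} (h : t ≤ t') :
    cutLevel c p ϖ t' ⊆ cutLevel c p ϖ t := fun _ hX i j =>
  (hX i j).trans (zpow_le_zpow_right_of_le_one₀ ((Valuation.pos_iff _).2 hϖ0) hϖ1 h)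

/-- `0` lies in every level. [folklore] -/
lemma zero_mem_cutLevel (t : ℤ) : (0 : Matrix {i // c i = c p} {i // c i = c p} F) ∈ cutLevel c p ϖ t :=
  fun i j => by simp

/-- **The levels exhaust** the matrices: every `X` lies in some level (valuation ring a discrete
valuation ring, `ϖ` a uniformizing element). ("`U` is the union of the `U_t`".) [folklore] -/
theorem exists_mem_cutLevel [IsDiscreteValuationRing 𝒪[F]] (hϖ : IsUniformizingElement ϖ)
    (X : Matrix {i // c i = c p} {i // c i = c p} F) : ∃ t : ℤ, X ∈ cutLevel c p ϖ t := by
  -- each non-zero entry is `ϖ^a · e` with `|e| = 1`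
  have key : ∀ x : F, ∃ a : ℤ, valuation F x ≤ valuation F ϖ ^ a := by
    intro x
    by_cases hx : x = 0
    · exact ⟨0, by simp [hx]⟩
    · obtain ⟨a, e, he, rfl⟩ := exists_eq_zpow_mul_of_ne_zero hϖ hx
      exact ⟨a, by rw [map_mul, map_zpow₀, he, mul_one]⟩
  choose a ha using key
  refine ⟨-∑ i, ∑ j, |a (X i j)|, fun i j => (ha (X i j)).trans ?_⟩
  refine zpow_le_zpow_right_of_le_one₀ ((Valuation.pos_iff _).2 hϖ.ne_zero) hϖ.valuation_le_one ?_
  have h1 : |a (X i j)| ≤ ∑ j', |a (X i j')| :=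
    Finset.single_le_sum (f := fun j' => |a (X i j')|) (fun _ _ => abs_nonneg _) (Finset.mem_univ j)
  have h2 : ∑ j', |a (X i j')| ≤ ∑ i', ∑ j', |a (X i' j')| :=
    Finset.single_le_sum (f := fun i' => ∑ j', |a (X i' j')|)
      (fun _ _ => Finset.sum_nonneg fun _ _ => abs_nonneg _) (Finset.mem_univ i)
  have h3 : -|a (X i j)| ≤ a (X i j) := neg_abs_le _
  omega

end Level

/-! ### Levels shrink to `0`; smooth vectors -/

section Small

variable {F : Type*} [Field F] [ValuativeRel F] [TopologicalSpace F] [IsNonarchimedeanLocalField F]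
  {n r : ℕ} (c : Fin n → Fin r) (p : Fin n)

/-- In a neighbourhood of a point of a double product space over finite index types one can
inscribe a box of neighbourhoods of the coordinates. [folklore] -/
lemma exists_forall_mem_nhds_of_mem_nhds_pi_pi {ι κ X : Type*} [Finite ι] [Finite κ]
    [TopologicalSpace X] {f : ι → κ → X} {S : Set (ι → κ → X)} (hS : S ∈ 𝓝 f) :
    ∃ s : ι → κ → Set X, (∀ i j, s i j ∈ 𝓝 (f i j)) ∧ ∀ g : ι → κ → X, (∀ i j, g i j ∈ s i j) → g ∈ S := by
  rw [nhds_pi, Filter.mem_pi] at hS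
  obtain ⟨I, -, t, ht, hIS⟩ := hS
  have ht' : ∀ i, ∃ s : κ → Set X, (∀ j, s j ∈ 𝓝 (f i j)) ∧ ∀ g : κ → X, (∀ j, g j ∈ s j) → g ∈ t i := by
    intro i
    have hi := ht i
    rw [nhds_pi, Filter.mem_pi] at hi
    obtain ⟨J, -, s, hs, hJ⟩ := hi
    exact ⟨s, hs, fun g hg => hJ fun j _ => hg j⟩
  choose s hs hst using ht'
  exact ⟨s, hs, fun g hg => hIS fun i _ => hst i (g i) (hg i)⟩

/-- **The levels are eventually inside every neighbourhood of `0`**: for a uniformizer `ϖ` of the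
non-archimedean local field `F` and `S ∈ 𝓝 0` there is `t` with `cutLevel c p ϖ t ⊆ S`.
[folklore] -/
theorem exists_cutLevel_subset_of_mem_nhds {ϖ : F} (hϖ : IsUniformizingElement ϖ)
    {S : Set (Matrix {i // c i = c p} {i // c i = c p} F)} (hS : S ∈ 𝓝 0) :
    ∃ t : ℤ, cutLevel c p ϖ t ⊆ S := by
  obtain ⟨s, hs, hsS⟩ := exists_forall_mem_nhds_of_mem_nhds_pi_pi (f := (0 : Matrix _ _ F)) hS
  -- for each entry a valuation ball inside `s i j`, and a power of `ϖ` inside the ball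
  have key : ∀ i j, ∃ t : ℤ, ∀ x : F, valuation F x ≤ valuation F ϖ ^ t → x ∈ s i j := by
    intro i j
    obtain ⟨γ, hγ⟩ := (IsValuativeTopology.mem_nhds_zero_iff _).mp (hs i j)
    -- a non-zero element of valuation `< γ`, written `ϖ^a e`
    obtain ⟨y, hy0, hy1⟩ := Valuation.IsNontrivial.exists_lt_one (v := valuation F)
    obtain ⟨g, hg⟩ := ValuativeRel.valuation_surjective (γ : ValueGroupWithZero F)
    have hg0 : g ≠ 0 := by rintro rfl; exact γ.ne_zero (by simpa using hg.symm)
    have hy : y ≠ 0 := by rintro rfl; simp at hy0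
    have hlt : valuation F (g * y) < γ := by
      rw [map_mul, hg]; exact mul_lt_of_lt_one_right (by simp) hy1
    obtain ⟨a, e, he, hgy⟩ := exists_eq_zpow_mul_of_ne_zero hϖ (mul_ne_zero hg0 hy)
    have ha : valuation F ϖ ^ a < γ := by
      rw [hgy, map_mul, map_zpow₀, he, mul_one] at hlt
      exact hlt
    exact ⟨a, fun x hx => hγ (hx.trans_lt ha)⟩
  choose t ht using key
  refine ⟨∑ i, ∑ j, |t i j|, fun X hX => hsS X fun i j => ht i j _ ((hX i j).trans ?_)⟩
  refine zpow_le_zpow_right_of_le_one₀ ((Valuation.pos_iff _).2 hϖ.ne_zero) hϖ.valuation_le_one ?_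
  have h1 : |t i j| ≤ ∑ j', |t i j'| :=
    Finset.single_le_sum (f := fun j' => |t i j'|) (fun _ _ => abs_nonneg _) (Finset.mem_univ j)
  have h2 : ∑ j', |t i j'| ≤ ∑ i', ∑ j', |t i' j'| :=
    Finset.single_le_sum (f := fun i' => ∑ j', |t i' j'|)
      (fun _ _ => Finset.sum_nonneg fun _ _ => abs_nonneg _) (Finset.mem_univ i)
  have h3 : t i j ≤ |t i j| := le_abs_self _
  omega

variable {W : Type*} [AddCommGroup W] [Module ℂ W]

/-- **A smooth linear form is invariant under a deep enough level of the cut unipotent group**: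
for `φ` in the smooth contragredient of a representation `τ` of the Levi there is `t` with
`φ (τ (cutElem c p X) w) = φ w` for all `X` of level `≥ t` and all `w` (the stabiliser of `φ` is
open and `X ↦ cutElem c p X` is continuous with value `1` at `0`). [folklore] -/
theorem exists_forall_apply_cutElem_eq {ϖ : F} (hϖ : IsUniformizingElement ϖ)
    (τ : Representation ℂ (Π a, GL {i // c i = a} F) W) {φ : Module.Dual ℂ W}
    (hφ : φ ∈ τ.contragredient) :
    ∃ t : ℤ, ∀ X ∈ cutLevel c p ϖ t, ∀ w : W, φ (τ (cutElem c p X) w) = φ w := by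
  haveI : IsTopologicalRing F := inferInstance
  rw [Representation.mem_contragredient] at hφ
  have hpre : (cutElem c p : Matrix _ _ F → _) ⁻¹' (τ.dual.stabilizerSubgroup φ : Set _) ∈ 𝓝 0 := by
    refine (continuous_cutElem c p).continuousAt.preimage_mem_nhds (hφ.mem_nhds ?_)
    rw [cutElem_zero]
    exact (τ.dual.stabilizerSubgroup φ).one_mem
  obtain ⟨t, ht⟩ := exists_cutLevel_subset_of_mem_nhds c p hϖ hpre
  refine ⟨t, fun X hX w => ?_⟩
  have h := ht (neg_mem_cutLevel hX)
  rw [Set.mem_preimage, SetLike.mem_coe, Representation.mem_stabilizerSubgroup, cutElem_neg] at h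
  have h' := LinearMap.congr_fun h w
  rw [Representation.dual_apply, Module.Dual.transpose_apply, LinearMap.comp_apply, inv_inv] at h'
  exact h'

end Small

/-! ### `W(U)` is the union of the `W(U_t)` -/

section Span

variable {F : Type*} [Field F] [ValuativeRel F] {n r : ℕ} (c : Fin n → Fin r) (p : Fin n)
  {W : Type*} [AddCommGroup W] [Module ℂ W]

/-- **Jacquet's observation `V(U) = ⋃_t V(U_t)`** for the cut unipotent group: an element of the
span `W(U)` of the `τ(u) y - y`, `u ∈ cutUnipotent F c p` (the kernel of the map to the
`U`-coinvariants, `Representation.Coinvariants.ker`) lies in the span of the `τ(cutElem X) y - y`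
with `X` of some fixed level `t` — finitely many `u`'s are involved and the levels exhaust `U`
and decrease in `t`. (Bernstein–Zelevinsky 1976, §3; Casselman 1995, §3–5.) [folklore] -/
theorem exists_mem_span_cutLevel_of_mem_coinvariantsKer [IsDiscreteValuationRing 𝒪[F]] {ϖ : F}
    (hϖ : IsUniformizingElement ϖ) (τ : Representation ℂ (Π a, GL {i // c i = a} F) W) {w : W}
    (hw : w ∈ Representation.Coinvariants.ker (τ.comp (cutUnipotent F c p).subtype)) :
    ∃ t : ℤ, w ∈ Submodule.span ℂ {y | ∃ X ∈ cutLevel c p ϖ t, ∃ v : W, y = τ (cutElem c p X) v - v} := by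
  -- the spans increase as the level decreases
  have hmono : ∀ {t t' : ℤ}, t ≤ t' →
      Submodule.span ℂ {y | ∃ X ∈ cutLevel c p ϖ t', ∃ v : W, y = τ (cutElem c p X) v - v} ≤
        Submodule.span ℂ {y | ∃ X ∈ cutLevel c p ϖ t, ∃ v : W, y = τ (cutElem c p X) v - v} :=
    fun h => Submodule.span_mono fun y ⟨X, hX, v, hy⟩ =>
      ⟨X, cutLevel_anti hϖ.ne_zero hϖ.valuation_le_one h hX, v, hy⟩
  induction hw using Submodule.span_induction with
  | mem y hy =>
    obtain ⟨⟨u, v⟩, rfl⟩ := hy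
    obtain ⟨X, hX⟩ := exists_eq_cutElem_of_mem_cutUnipotent c p u.2
    obtain ⟨t, ht⟩ := exists_mem_cutLevel (c := c) (p := p) hϖ X
    refine ⟨t, Submodule.subset_span ⟨X, ht, v, ?_⟩⟩
    change τ ((u : Π a, GL {i // c i = a} F)) v - v = _
    rw [hX]
  | zero => exact ⟨0, Submodule.zero_mem _⟩
  | add x y _ _ hx hy =>
    obtain ⟨t₁, h₁⟩ := hx
    obtain ⟨t₂, h₂⟩ := hy
    exact ⟨min t₁ t₂, Submodule.add_mem _ (hmono (min_le_left _ _) h₁) (hmono (min_le_right _ _) h₂)⟩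
  | smul a x _ hx =>
    obtain ⟨t, h⟩ := hx
    exact ⟨t, Submodule.smul_mem _ a h⟩

end Span

/-! ### Contraction of the cut unipotent group by the torus -/

section Conj

variable {F : Type*} [Field F] {n r : ℕ} (c : Fin n → Fin r) (p : Fin n) {ϖ : F} (hϖ : ϖ ≠ 0)

/-- The matrix obtained from `X` by the conjugation scaling `ϖ^{e i - e j}` at the cut positions
(and `0` elsewhere). [folklore] -/
def cutScale (e : Fin n → ℤ) (X : Matrix {i // c i = c p} {i // c i = c p} F) :
    Matrix {i // c i = c p} {i // c i = c p} F :=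
  Matrix.of fun i j => if i.1 ≤ p ∧ p < j.1 then ϖ ^ (e i.1 - e j.1) * X i j else 0

/-- Entries of `cutScale`. [folklore] -/
lemma cutScale_apply (e : Fin n → ℤ) (X : Matrix {i // c i = c p} {i // c i = c p} F)
    (i j : {i // c i = c p}) :
    cutScale c p (ϖ := ϖ) e X i j = if i.1 ≤ p ∧ p < j.1 then ϖ ^ (e i.1 - e j.1) * X i j else 0 :=
  rfl

/-- **Conjugation formula**: `diag(ϖ^e) · cutElem X · diag(ϖ^e)⁻¹ = cutElem (ϖ^{e i - e j} X i j)`.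
(Casselman 1995, Prop. 1.4.3: the torus acts on the root subgroups through the roots.)
[folklore] -/
theorem leviZpowDiag_mul_cutElem_mul_inv (e : Fin n → ℤ)
    (X : Matrix {i // c i = c p} {i // c i = c p} F) :
    leviZpowDiag c hϖ e * cutElem c p X * (leviZpowDiag c hϖ e)⁻¹ =
      cutElem c p (cutScale c p (ϖ := ϖ) e X) := by
  rw [← leviZpowDiag_neg]
  funext a
  rw [Pi.mul_apply, Pi.mul_apply]
  by_cases ha : a = c p
  · subst ha
    rw [cutElem_apply_self, cutElem_apply_self]
    refine Units.ext ?_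
    rw [Units.val_mul, Units.val_mul, coe_leviZpowDiag_apply, coe_leviZpowDiag_apply, coe_cutGL,
      coe_cutGL, mul_add, mul_one, add_mul, Matrix.diagonal_mul_diagonal]
    congr 1
    · rw [← Matrix.diagonal_one]
      congr 1
      funext i
      rw [Pi.neg_apply, ← zpow_add₀ hϖ, add_neg_cancel, zpow_zero]
    · ext i j
      rw [Matrix.mul_diagonal, Matrix.diagonal_mul, cutTrunc_apply, cutTrunc_apply, cutScale_apply]
      split_ifs with h
      · rw [Pi.neg_apply, zpow_neg, zpow_sub₀ hϖ, div_eq_mul_inv]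
        ring
      · rw [mul_zero, zero_mul]
  · rw [cutElem_apply_of_ne c p _ ha, cutElem_apply_of_ne c p _ ha, mul_one, ← Pi.mul_apply,
      ← leviZpowDiag_add, add_neg_cancel, leviZpowDiag_zero, Pi.one_apply]

variable [ValuativeRel F]

include hϖ in
/-- **The level rises by the gap.** If `e` is antitone on the block of `p` and has gap at least
`G` at the cut, `e q + G ≤ e p` for every `q > p` in the block, then conjugation by `diag(ϖ^e)`
carries level `t` into level `t + G`: for a cut position `(i, j)` (`i ≤ p < j`),
`e i - e j ≥ e p - e j ≥ G`. (`|ϖ| ≤ 1`.) [folklore] -/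
theorem cutScale_mem_cutLevel_of_gap (hϖ1 : valuation F ϖ ≤ 1) {e : Fin n → ℤ}
    (hanti : ∀ i j : Fin n, i ≤ j → c i = c p → c j = c p → e j ≤ e i) {G : ℤ}
    (hgap : ∀ q : Fin n, p < q → c q = c p → e q + G ≤ e p) {t : ℤ}
    {X : Matrix {i // c i = c p} {i // c i = c p} F} (hX : X ∈ cutLevel c p ϖ t) :
    cutScale c p (ϖ := ϖ) e X ∈ cutLevel c p ϖ (t + G) := by
  intro i j
  rw [cutScale_apply]
  split_ifs with h
  · have hij : G ≤ e i.1 - e j.1 := by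
      have h1 := hanti i.1 p h.1 i.2 rfl
      have h2 := hgap j.1 h.2 j.2
      omega
    rw [map_mul, map_zpow₀, add_comm t G, zpow_add₀ ((Valuation.ne_zero_iff _).2 hϖ)]
    exact mul_le_mul' (zpow_le_zpow_right_of_le_one₀ ((Valuation.pos_iff _).2 hϖ) hϖ1 hij) (hX i j)
  · simp

end Conj

end Literature.NumberTheory.Automorphic
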